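import Literature.NumberTheory.LFunctions.BCHCrossMainPair
import Literature.NumberTheory.LFunctions.BCHCrossTermErrorSums
import HarnessLib

/-!
# The cross term of the BCH mean square: the main sum on a short block

Topic `Literature/NumberTheory/LFunctions`. Everything in this file is PROVED (no definitions, no
named facts).

Summing `BCH.norm_pairSum_sub_main_le` over the pairs `(h, k)` with the weights `a_h ā_k (2π/k)` of
`BCH.mainSum_eq` evaluates the stationary-phase main sum of the cross term of the Balasubramanian–
Conrey–Heath-Brown mean square on a short block `[T, T']`, `T' ≤ 2T` (in practice `T' = (1+η)T`):

* `BCH.sum_gcd_div_le` — `Σ_{h,k ≤ N} (h,k)/(hk) ≤ (1 + log N)³`;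
* `BCH.pairWeight_mul_main` — `(2π/k) · (T'−T)/(2πh') · log(h'/k') = (T'−T) log(h/k)/[h,k]`;
* `BCH.norm_mainSum_sub_le` — **the main sum**: with `X = ⌊√(T'/2π)⌋`, `2N ≤ √(T'/2π)`, `|a_h| ≤ B`,
  `‖e^{-iπ/4} Σ_{h,k} a_h ā_k (hk)^{-1/2} Σ_{μ,ν ≤ X} (μν)^{-1/2} crossMain − (T'−T) Σ_{k ≤ h ≤ N} a_h ā_k log(h/k)/[h,k]‖`
  `  ≤ B² (2η(T'−T)(1 + log N)³ + 2πN(1 + log N)(7(T'−T)/√(2πT) + 2√(T'/2π) + 2) + 2π(1 + log N)(XN(1 + log N) + N²))`;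
* `BCH.two_re_pairMain_eq` — symmetrisation: `2 Re Σ_{k ≤ h} a_h ā_k log(h/k)/[h,k] = Σ_{h,k} Re(a_h ā_k) |log(h/k)|/[h,k]`.

## References

* [Titchmarsh1986] E. C. Titchmarsh, *The Theory of the Riemann Zeta-Function*, 2nd ed. (1986), §9.22.
* [BalasubramanianConreyHeathBrown1985] J. reine angew. Math. 357 (1985), 161–181.
-/

noncomputable section

open Finset Real Complex
open scoped ComplexConjugate

namespace Literature.NumberTheory.LFunctions.BCH

/-! ### `Σ (h,k)/(hk) ≤ (1 + log N)³` -/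

/-- `Σ_{h ≤ N, d ∣ h} 1/h ≤ (1 + log N)/d` for `d ≥ 1`. [folklore] -/
theorem sum_filter_dvd_one_div_le (N : ℕ) {d : ℕ} (hd : 0 < d) :
    ∑ h ∈ (Finset.Icc 1 N).filter (fun h => d ∣ h), 1 / (h : ℝ) ≤ (1 + Real.log N) / d := by
  have hdR : (0 : ℝ) < d := by exact_mod_cast hd
  -- reindex `h = d m`, `m ≤ N/d`
  have himage : (Finset.Icc 1 N).filter (fun h => d ∣ h) = (Finset.Icc 1 (N / d)).image (fun m => d * m) := by
    ext h
    simp only [Finset.mem_filter, Finset.mem_Icc, Finset.mem_image]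
    constructor
    · rintro ⟨⟨h1, h2⟩, m, rfl⟩
      refine ⟨m, ⟨?_, ?_⟩, rfl⟩
      · rcases Nat.eq_zero_or_pos m with rfl | hm
        · simp at h1
        · exact hm
      · exact (Nat.le_div_iff_mul_le hd).2 (by rw [mul_comm]; exact h2)
    · rintro ⟨m, ⟨h1, h2⟩, rfl⟩
      refine ⟨⟨Nat.mul_pos hd h1, ?_⟩, dvd_mul_right _ _⟩
      have := (Nat.le_div_iff_mul_le hd).1 h2
      rw [mul_comm]; exact this
  rw [himage, Finset.sum_image (fun m _ m' _ hmm' => Nat.eq_of_mul_eq_mul_left hd hmm')]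
  have e : ∀ m ∈ Finset.Icc 1 (N / d), 1 / ((d * m : ℕ) : ℝ) = (1 / d) * (1 / (m : ℝ)) := by
    intro m _; push_cast; rw [one_div_mul_one_div]
  rw [Finset.sum_congr rfl e, ← Finset.mul_sum]
  have h1 := sum_one_div_le_log (N / d)
  have h2 : Real.log ((N / d : ℕ) : ℝ) ≤ Real.log N := by
    rcases Nat.eq_zero_or_pos (N / d) with h0 | hpos
    · rw [h0]; simp only [Nat.cast_zero, Real.log_zero]; exact Real.log_natCast_nonneg N
    · exact Real.log_le_log (by exact_mod_cast hpos) (by exact_mod_cast Nat.div_le_self N d)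
  calc (1 / (d : ℝ)) * ∑ m ∈ Finset.Icc 1 (N / d), 1 / (m : ℝ) ≤ (1 / (d : ℝ)) * (1 + Real.log N) :=
        mul_le_mul_of_nonneg_left (by linarith) (by positivity)
    _ = (1 + Real.log N) / d := by rw [div_eq_mul_one_div]; ring

/-- **`Σ_{h,k ≤ N} (h,k)/(hk) ≤ (1 + log N)³`** (bound `(h,k)` by the sum of all common divisors and
exchange the order of summation). [folklore] -/
theorem sum_gcd_div_le (N : ℕ) :
    ∑ h ∈ Finset.Icc 1 N, ∑ k ∈ Finset.Icc 1 N, (Nat.gcd h k : ℝ) / ((h : ℝ) * k) ≤ (1 + Real.log N) ^ 3 := by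
  have hlog : 0 ≤ Real.log (N : ℝ) := Real.log_natCast_nonneg N
  -- `(h,k) ≤ Σ_{d ≤ N, d ∣ h, d ∣ k} d`
  have hgcd : ∀ h ∈ Finset.Icc 1 N, ∀ k ∈ Finset.Icc 1 N, (Nat.gcd h k : ℝ) ≤
      ∑ d ∈ Finset.Icc 1 N, if d ∣ h ∧ d ∣ k then (d : ℝ) else 0 := by
    intro h hh k hk
    have hh1 : 1 ≤ h := (Finset.mem_Icc.1 hh).1
    have hmem : Nat.gcd h k ∈ Finset.Icc 1 N := by
      rw [Finset.mem_Icc]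
      exact ⟨Nat.gcd_pos_of_pos_left k hh1, (Nat.gcd_le_left k hh1).trans (Finset.mem_Icc.1 hh).2⟩
    have := Finset.single_le_sum (f := fun d => if d ∣ h ∧ d ∣ k then (d : ℝ) else 0)
      (fun d _ => by split_ifs <;> positivity) hmem
    simp only [Nat.gcd_dvd_left, Nat.gcd_dvd_right, and_self, if_true] at this
    exact this
  calc ∑ h ∈ Finset.Icc 1 N, ∑ k ∈ Finset.Icc 1 N, (Nat.gcd h k : ℝ) / ((h : ℝ) * k)
      ≤ ∑ h ∈ Finset.Icc 1 N, ∑ k ∈ Finset.Icc 1 N,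
          ∑ d ∈ Finset.Icc 1 N, (if d ∣ h ∧ d ∣ k then (d : ℝ) else 0) * (1 / ((h : ℝ) * k)) := by
        refine Finset.sum_le_sum fun h hh => Finset.sum_le_sum fun k hk => ?_
        rw [← Finset.sum_mul, div_eq_mul_one_div]
        exact mul_le_mul_of_nonneg_right (hgcd h hh k hk) (by positivity)
    _ = ∑ d ∈ Finset.Icc 1 N, (d : ℝ) * ((∑ h ∈ (Finset.Icc 1 N).filter (fun h => d ∣ h), 1 / (h : ℝ)) *
          (∑ k ∈ (Finset.Icc 1 N).filter (fun k => d ∣ k), 1 / (k : ℝ))) := by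
        -- bring the `d`-sum outside
        have step1 : ∀ h ∈ Finset.Icc 1 N, ∑ k ∈ Finset.Icc 1 N, ∑ d ∈ Finset.Icc 1 N,
            (if d ∣ h ∧ d ∣ k then (d : ℝ) else 0) * (1 / ((h : ℝ) * k)) =
            ∑ d ∈ Finset.Icc 1 N, ∑ k ∈ Finset.Icc 1 N,
              (if d ∣ h ∧ d ∣ k then (d : ℝ) else 0) * (1 / ((h : ℝ) * k)) := fun h _ => Finset.sum_comm
        rw [Finset.sum_congr rfl step1, Finset.sum_comm]
        refine Finset.sum_congr rfl fun d _ => ?_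
        -- factorise the `(h,k)`-sum for fixed `d`
        have hpt : ∀ h k : ℕ, (if d ∣ h ∧ d ∣ k then (d : ℝ) else 0) * (1 / ((h : ℝ) * k)) =
            (d : ℝ) * ((if d ∣ h then 1 / (h : ℝ) else 0) * (if d ∣ k then 1 / (k : ℝ) else 0)) := by
          intro h k
          by_cases h1 : d ∣ h
          · by_cases h2 : d ∣ k
            · rw [if_pos ⟨h1, h2⟩, if_pos h1, if_pos h2]; ring
            · rw [if_neg (fun hh => h2 hh.2), if_neg h2]; ring
          · rw [if_neg (fun hh => h1 hh.1), if_neg h1]; ring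
        simp_rw [hpt, ← Finset.mul_sum, ← Finset.sum_mul, Finset.sum_filter]
    _ ≤ ∑ d ∈ Finset.Icc 1 N, (d : ℝ) * (((1 + Real.log N) / d) * ((1 + Real.log N) / d)) := by
        refine Finset.sum_le_sum fun d hd => ?_
        have hd0 : 0 < d := (Finset.mem_Icc.1 hd).1
        have hs0 : 0 ≤ ∑ h ∈ (Finset.Icc 1 N).filter (fun h => d ∣ h), 1 / (h : ℝ) :=
          Finset.sum_nonneg fun h _ => by positivity
        have := sum_filter_dvd_one_div_le N hd0
        refine mul_le_mul_of_nonneg_left ?_ (Nat.cast_nonneg d)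
        exact mul_le_mul this this hs0 (by positivity)
    _ = (1 + Real.log N) ^ 2 * ∑ d ∈ Finset.Icc 1 N, 1 / (d : ℝ) := by
        rw [Finset.mul_sum]
        refine Finset.sum_congr rfl fun d hd => ?_
        have hd0 : (0 : ℝ) < d := by exact_mod_cast (Finset.mem_Icc.1 hd).1
        field_simp
    _ ≤ (1 + Real.log N) ^ 2 * (1 + Real.log N) :=
        mul_le_mul_of_nonneg_left (sum_one_div_le_log N) (by positivity)
    _ = (1 + Real.log N) ^ 3 := by ring

/-! ### The weight of a pair against its main term -/

/-- `k · h' = [h, k]` as reals (`h' = h/(h,k)`). [folklore] -/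
theorem cast_mul_div_gcd_eq_lcm (h k : ℕ) : (k : ℝ) * ((h / Nat.gcd h k : ℕ) : ℝ) = (Nat.lcm h k : ℝ) := by
  have e : k * (h / Nat.gcd h k) = Nat.lcm h k := by
    rw [Nat.lcm, ← Nat.mul_div_assoc k (Nat.gcd_dvd_left h k), mul_comm]
  exact_mod_cast e

/-- **`(2π/k) · (T'−T)/(2πh') · log(h'/k') = (T'−T) · log(h/k)/[h,k]`.** [folklore] -/
theorem pairWeight_mul_main {h k : ℕ} (hh : 0 < h) (hk : 0 < k) (T T' : ℝ) :
    2 * π / k * ((T' - T) / (2 * π * ((h / Nat.gcd h k : ℕ) : ℝ)) *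
      Real.log (((h / Nat.gcd h k : ℕ) : ℝ) / ((k / Nat.gcd h k : ℕ) : ℝ))) =
      (T' - T) * (Real.log ((h : ℝ) / k) / (Nat.lcm h k : ℝ)) := by
  have hπ := Real.pi_pos
  have hkR : (0 : ℝ) < k := by exact_mod_cast hk
  have hg0 : 0 < Nat.gcd h k := Nat.gcd_pos_of_pos_right h hk
  have hh'0 : (0 : ℝ) < ((h / Nat.gcd h k : ℕ) : ℝ) := by
    exact_mod_cast Nat.div_pos (Nat.le_of_dvd hh (Nat.gcd_dvd_left h k)) hg0
  rw [← div_eq_div_gcd h k hk, ← cast_mul_div_gcd_eq_lcm h k]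
  field_simp

/-- `(2π/k) · (T'−T)/(2πh') = (T'−T) · (h,k)/(hk)`. [folklore] -/
theorem pairWeight_mul_A {h k : ℕ} (hh : 0 < h) (hk : 0 < k) (T T' : ℝ) :
    2 * π / k * ((T' - T) / (2 * π * ((h / Nat.gcd h k : ℕ) : ℝ))) =
      (T' - T) * ((Nat.gcd h k : ℝ) / ((h : ℝ) * k)) := by
  have hπ := Real.pi_pos
  have hkR : (0 : ℝ) < k := by exact_mod_cast hk
  have hhR : (0 : ℝ) < h := by exact_mod_cast hh
  have hg0 : (0 : ℝ) < Nat.gcd h k := by exact_mod_cast Nat.gcd_pos_of_pos_right h hk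
  obtain ⟨eh, -⟩ := cast_eq_gcd_mul h k
  have hh'0 : (0 : ℝ) < ((h / Nat.gcd h k : ℕ) : ℝ) := by
    exact_mod_cast Nat.div_pos (Nat.le_of_dvd hh (Nat.gcd_dvd_left h k)) (Nat.gcd_pos_of_pos_right h hk)
  rw [eh]
  field_simp

/-- The non-divisible weight: `(2π/k)(X/k' + 1) k' (1 + log k') ≤ 2π (X/k + 1)(1 + log N)` for
`k ≤ N`. [folklore] -/
theorem pairWeight_mul_nondiv_le {h k N X : ℕ} (hk : 0 < k) (hkN : k ≤ N) :
    2 * π / k * ((((X / (k / Nat.gcd h k) : ℕ) : ℝ) + 1) *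
      (((k / Nat.gcd h k : ℕ) : ℝ) * (1 + Real.log ((k / Nat.gcd h k : ℕ) : ℝ)))) ≤
      2 * π * ((X : ℝ) / k + 1) * (1 + Real.log N) := by
  have hπ := Real.pi_pos
  set k' := k / Nat.gcd h k with hk'
  have hg0 : 0 < Nat.gcd h k := Nat.gcd_pos_of_pos_right h hk
  have hk'0 : 0 < k' := Nat.div_pos (Nat.le_of_dvd hk (Nat.gcd_dvd_right h k)) hg0
  have hk'k : k' ≤ k := Nat.div_le_self k _
  have hkR : (0 : ℝ) < k := by exact_mod_cast hk
  have hk'R : (0 : ℝ) < k' := by exact_mod_cast hk'0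
  have hk'kR : (k' : ℝ) ≤ k := by exact_mod_cast hk'k
  have hlogk' : Real.log (k' : ℝ) ≤ Real.log N :=
    Real.log_le_log hk'R (by exact_mod_cast hk'k.trans hkN)
  have hlog0 : 0 ≤ Real.log (k' : ℝ) := Real.log_natCast_nonneg k'
  -- `(X/k' + 1) k' ≤ X + k'`
  have h1 : (((X / k' : ℕ) : ℝ) + 1) * k' ≤ X + k' := by
    have : ((X / k' : ℕ) : ℝ) * k' ≤ X := by exact_mod_cast Nat.div_mul_le_self X k'
    linarith
  calc 2 * π / k * ((((X / k' : ℕ) : ℝ) + 1) * ((k' : ℝ) * (1 + Real.log (k' : ℝ))))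
      = 2 * π / k * (((((X / k' : ℕ) : ℝ) + 1) * k') * (1 + Real.log (k' : ℝ))) := by ring
    _ ≤ 2 * π / k * (((X : ℝ) + k') * (1 + Real.log N)) := by
        gcongr
    _ = 2 * π * (((X : ℝ) + k') / k) * (1 + Real.log N) := by field_simp
    _ ≤ 2 * π * ((X : ℝ) / k + 1) * (1 + Real.log N) := by
        have : ((X : ℝ) + k') / k ≤ (X : ℝ) / k + 1 := by
          rw [add_div]; gcongr; rw [div_le_one hkR]; exact hk'kR
        have h0 : 0 ≤ 1 + Real.log (N : ℝ) := by linarith [Real.log_natCast_nonneg N]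
        gcongr

/-! ### The main sum on a block -/

/-- **The stationary-phase main sum of the cross term on `[T, T']`.** For `0 < T ≤ T' ≤ 2T`,
`X = ⌊√(T'/2π)⌋`, `2N ≤ √(T'/2π)`, `|a_h| ≤ B`:
`‖e^{-iπ/4} Σ_{h,k ≤ N} a_h ā_k (hk)^{-1/2} Σ_{μ,ν ≤ X} (μν)^{-1/2} crossMain − (T'−T) Σ_{k ≤ h ≤ N} a_h ā_k log(h/k)/[h,k]‖`
`  ≤ B² (2η(T'−T)(1 + log N)³ + 2πN(1 + log N)(7(T'−T)/√(2πT) + 2√(T'/2π) + 2) + 2π(1 + log N)(XN(1 + log N) + N²))`.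
[cite: Titchmarsh1986, §9.22] -/
theorem norm_mainSum_sub_le (a : ℕ → ℂ) (N : ℕ) {T T' B : ℝ} (hT : 0 < T) (hTT' : T ≤ T')
    (hT'2 : T' ≤ 2 * T) (hN : 2 * (N : ℝ) ≤ Real.sqrt (T' / (2 * π)))
    (hB : ∀ h ∈ Finset.Icc 1 N, ‖a h‖ ≤ B) :
    ‖cexp (-(I * (π / 4 : ℝ))) * ∑ h ∈ Finset.Icc 1 N, ∑ k ∈ Finset.Icc 1 N,
        a h * conj (a k) * ((((h : ℝ) * k) ^ (-(1 / 2 : ℝ)) : ℝ) : ℂ) *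
          ∑ μ ∈ Finset.Icc 1 ⌊Real.sqrt (T' / (2 * π))⌋₊, ∑ ν ∈ Finset.Icc 1 ⌊Real.sqrt (T' / (2 * π))⌋₊,
            ((((μ : ℝ) * ν) ^ (-(1 / 2 : ℝ)) : ℝ) : ℂ) * crossMain T T' h k μ ν -
      ((T' - T : ℝ) : ℂ) * ∑ h ∈ Finset.Icc 1 N, ∑ k ∈ Finset.Icc 1 N,
        (if k ≤ h then a h * conj (a k) * ((Real.log ((h : ℝ) / k) / (Nat.lcm h k : ℝ) : ℝ) : ℂ) else 0)‖ ≤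
      B ^ 2 * (2 * ((T' - T) / T) * (T' - T) * (1 + Real.log N) ^ 3 +
        2 * π * N * (1 + Real.log N) *
          (7 * ((T' - T) / Real.sqrt (2 * π * T)) + 2 * Real.sqrt (T' / (2 * π)) + 2) +
        2 * π * (1 + Real.log N) * ((⌊Real.sqrt (T' / (2 * π))⌋₊ : ℝ) * N * (1 + Real.log N) + (N : ℝ) ^ 2)) := by
  rcases Nat.eq_zero_or_pos N with rfl | hNpos
  · have : 0 ≤ T' - T := by linarith
    simp
    positivity
  have hB0 : 0 ≤ B := le_trans (norm_nonneg _) (hB 1 (Finset.mem_Icc.2 ⟨le_rfl, hNpos⟩))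
  have hπ := Real.pi_pos
  have hT'0 : 0 ≤ T' - T := by linarith
  set X := ⌊Real.sqrt (T' / (2 * π))⌋₊ with hX
  set η := (T' - T) / T with hη
  set C₀ := 7 * ((T' - T) / Real.sqrt (2 * π * T)) + 2 * Real.sqrt (T' / (2 * π)) + 2 with hC₀
  have hη0 : 0 ≤ η := by positivity
  have hC₀0 : 0 ≤ C₀ := by positivity
  have hlogN : 0 ≤ Real.log (N : ℝ) := Real.log_natCast_nonneg N
  rw [mainSum_eq a N X T T', Finset.mul_sum, ← Finset.sum_sub_distrib]
  -- per pair
  have hpair : ∀ h ∈ Finset.Icc 1 N, ∀ k ∈ Finset.Icc 1 N,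
      ‖a h * conj (a k) * (((2 * π / k : ℝ)) : ℂ) *
          ∑ μ ∈ Finset.Icc 1 X, ∑ ν ∈ crossNuSet T T' X h k μ, cexp (-I * crossFreq h k μ ν) -
        ((T' - T : ℝ) : ℂ) * (if k ≤ h then a h * conj (a k) *
          ((Real.log ((h : ℝ) / k) / (Nat.lcm h k : ℝ) : ℝ) : ℂ) else 0)‖ ≤
      B ^ 2 * (2 * η * (T' - T) * ((Nat.gcd h k : ℝ) / ((h : ℝ) * k)) + 2 * π / k * C₀ +
        2 * π * ((X : ℝ) / k + 1) * (1 + Real.log N)) := by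
    intro h hh k hk
    have hh0 : 0 < h := (Finset.mem_Icc.1 hh).1
    have hk0 : 0 < k := (Finset.mem_Icc.1 hk).1
    have hhN : h ≤ N := (Finset.mem_Icc.1 hh).2
    have hkN : k ≤ N := (Finset.mem_Icc.1 hk).2
    have hkR : (0 : ℝ) < k := by exact_mod_cast hk0
    have hP := norm_pairSum_sub_main_le hT hTT' hT'2 hh0 hk0 hhN hN
    rw [← hX] at hP
    set PS := ∑ μ ∈ Finset.Icc 1 X, ∑ ν ∈ crossNuSet T T' X h k μ, cexp (-I * crossFreq h k μ ν) with hPS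
    set Mhk : ℝ := (T' - T) / (2 * π * ((h / Nat.gcd h k : ℕ) : ℝ)) *
      Real.log (((h / Nat.gcd h k : ℕ) : ℝ) / ((k / Nat.gcd h k : ℕ) : ℝ)) with hMhk
    -- rewrite the subtracted main term through `pairWeight_mul_main`
    have e : a h * conj (a k) * (((2 * π / k : ℝ)) : ℂ) * PS -
        ((T' - T : ℝ) : ℂ) * (if k ≤ h then a h * conj (a k) *
          ((Real.log ((h : ℝ) / k) / (Nat.lcm h k : ℝ) : ℝ) : ℂ) else 0) =
        a h * conj (a k) * (((2 * π / k : ℝ)) : ℂ) * (PS - (if k ≤ h then ((Mhk : ℝ) : ℂ) else 0)) := by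
      split_ifs with hkh
      · have := pairWeight_mul_main hh0 hk0 T T'
        rw [← hMhk] at this
        rw [mul_sub]
        congr 1
        rw [show ((T' - T : ℝ) : ℂ) * (a h * conj (a k) * ((Real.log ((h : ℝ) / k) / (Nat.lcm h k : ℝ) : ℝ) : ℂ)) =
          a h * conj (a k) * (((T' - T) * (Real.log ((h : ℝ) / k) / (Nat.lcm h k : ℝ)) : ℝ) : ℂ) by push_cast; ring,
          ← this]
        push_cast; ring
      · simp
    rw [e, norm_mul, norm_mul, norm_mul, Complex.norm_conj, Complex.norm_real, Real.norm_of_nonneg (by positivity)]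
    have hab : ‖a h‖ * ‖a k‖ ≤ B ^ 2 := by
      rw [sq]; exact mul_le_mul (hB h hh) (hB k hk) (norm_nonneg _) hB0
    have hw1 := pairWeight_mul_A hh0 hk0 T T'
    have hw3 := pairWeight_mul_nondiv_le (h := h) (X := X) hk0 hkN
    calc ‖a h‖ * ‖a k‖ * (2 * π / k) * ‖PS - (if k ≤ h then ((Mhk : ℝ) : ℂ) else 0)‖
        ≤ B ^ 2 * ((2 * π / k) * (2 * ((T' - T) / T) * ((T' - T) / (2 * π * ((h / Nat.gcd h k : ℕ) : ℝ))) +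
            7 * ((T' - T) / Real.sqrt (2 * π * T)) + 2 * Real.sqrt (T' / (2 * π)) + 2 +
            (((X / (k / Nat.gcd h k) : ℕ) : ℝ) + 1) *
              (((k / Nat.gcd h k : ℕ) : ℝ) * (1 + Real.log ((k / Nat.gcd h k : ℕ) : ℝ))))) := by
          rw [mul_assoc (‖a h‖ * ‖a k‖)]
          exact mul_le_mul hab (mul_le_mul_of_nonneg_left hP (by positivity)) (by positivity) (by positivity)
      _ = B ^ 2 * (2 * η * ((2 * π / k) * ((T' - T) / (2 * π * ((h / Nat.gcd h k : ℕ) : ℝ)))) +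
            2 * π / k * C₀ + 2 * π / k * ((((X / (k / Nat.gcd h k) : ℕ) : ℝ) + 1) *
              (((k / Nat.gcd h k : ℕ) : ℝ) * (1 + Real.log ((k / Nat.gcd h k : ℕ) : ℝ))))) := by
          rw [hη, hC₀]; ring
      _ ≤ B ^ 2 * (2 * η * (T' - T) * ((Nat.gcd h k : ℝ) / ((h : ℝ) * k)) + 2 * π / k * C₀ +
            2 * π * ((X : ℝ) / k + 1) * (1 + Real.log N)) := by
          rw [hw1, ← mul_assoc]
          gcongr
  -- sum the per-pair bounds
  have hinner : ∀ h ∈ Finset.Icc 1 N,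
      ‖∑ k ∈ Finset.Icc 1 N, a h * conj (a k) * (((2 * π / k : ℝ)) : ℂ) *
          ∑ μ ∈ Finset.Icc 1 X, ∑ ν ∈ crossNuSet T T' X h k μ, cexp (-I * crossFreq h k μ ν) -
        ((T' - T : ℝ) : ℂ) * ∑ k ∈ Finset.Icc 1 N, (if k ≤ h then a h * conj (a k) *
          ((Real.log ((h : ℝ) / k) / (Nat.lcm h k : ℝ) : ℝ) : ℂ) else 0)‖ ≤
      ∑ k ∈ Finset.Icc 1 N, B ^ 2 * (2 * η * (T' - T) * ((Nat.gcd h k : ℝ) / ((h : ℝ) * k)) + 2 * π / k * C₀ +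
        2 * π * ((X : ℝ) / k + 1) * (1 + Real.log N)) := by
    intro h hh
    rw [Finset.mul_sum (s := Finset.Icc 1 N) (a := ((T' - T : ℝ) : ℂ))
      (f := fun k => (if k ≤ h then a h * conj (a k) *
          ((Real.log ((h : ℝ) / k) / (Nat.lcm h k : ℝ) : ℝ) : ℂ) else 0)), ← Finset.sum_sub_distrib]
    exact (norm_sum_le _ _).trans (Finset.sum_le_sum fun k hk => hpair h hh k hk)
  refine (norm_sum_le _ _).trans ((Finset.sum_le_sum hinner).trans ?_)
  have hG := sum_gcd_div_le N
  have hHN : ∑ k ∈ Finset.Icc 1 N, 1 / (k : ℝ) ≤ 1 + Real.log N := sum_one_div_le_log N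
  have hHN0 : 0 ≤ ∑ k ∈ Finset.Icc 1 N, 1 / (k : ℝ) := Finset.sum_nonneg fun k _ => by positivity
  -- evaluate the three weight sums
  have e1 : ∑ h ∈ Finset.Icc 1 N, ∑ k ∈ Finset.Icc 1 N,
      B ^ 2 * (2 * η * (T' - T) * ((Nat.gcd h k : ℝ) / ((h : ℝ) * k)) + 2 * π / k * C₀ +
        2 * π * ((X : ℝ) / k + 1) * (1 + Real.log N)) =
      B ^ 2 * (2 * η * (T' - T) * ∑ h ∈ Finset.Icc 1 N, ∑ k ∈ Finset.Icc 1 N, (Nat.gcd h k : ℝ) / ((h : ℝ) * k) +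
        2 * π * C₀ * (N * ∑ k ∈ Finset.Icc 1 N, 1 / (k : ℝ)) +
        2 * π * (1 + Real.log N) * ((X : ℝ) * (N * ∑ k ∈ Finset.Icc 1 N, 1 / (k : ℝ)) + (N : ℝ) * N)) := by
    have ept : ∀ h k : ℕ, B ^ 2 * (2 * η * (T' - T) * ((Nat.gcd h k : ℝ) / ((h : ℝ) * k)) + 2 * π / k * C₀ +
        2 * π * ((X : ℝ) / k + 1) * (1 + Real.log N)) =
        B ^ 2 * (2 * η * (T' - T)) * ((Nat.gcd h k : ℝ) / ((h : ℝ) * k)) +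
        (B ^ 2 * (2 * π * C₀) + B ^ 2 * (2 * π * (1 + Real.log N)) * X) * (1 / (k : ℝ)) +
        B ^ 2 * (2 * π * (1 + Real.log N)) := by
      intro h k; ring
    simp_rw [ept, Finset.sum_add_distrib, ← Finset.mul_sum, Finset.sum_const, nsmul_eq_mul, Nat.card_Icc,
      Nat.add_sub_cancel]
    ring
  rw [e1]
  have hB2 : 0 ≤ B ^ 2 := sq_nonneg B
  have t1 : 2 * η * (T' - T) * ∑ h ∈ Finset.Icc 1 N, ∑ k ∈ Finset.Icc 1 N, (Nat.gcd h k : ℝ) / ((h : ℝ) * k) ≤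
      2 * η * (T' - T) * (1 + Real.log N) ^ 3 := mul_le_mul_of_nonneg_left hG (by positivity)
  have t2 : 2 * π * C₀ * (N * ∑ k ∈ Finset.Icc 1 N, 1 / (k : ℝ)) ≤ 2 * π * C₀ * (N * (1 + Real.log N)) := by
    gcongr
  have t3 : 2 * π * (1 + Real.log N) * ((X : ℝ) * (N * ∑ k ∈ Finset.Icc 1 N, 1 / (k : ℝ)) + (N : ℝ) * N) ≤
      2 * π * (1 + Real.log N) * ((X : ℝ) * (N * (1 + Real.log N)) + (N : ℝ) * N) := by
    gcongr
  rw [hη] at t1 ⊢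
  rw [hC₀] at t2
  nlinarith [t1, t2, t3, hB2]

/-! ### Symmetrisation -/

/-- **`2 Re Σ_{k ≤ h} a_h ā_k log(h/k)/[h,k] = Σ_{h,k} Re(a_h ā_k) |log(h/k)|/[h,k]`** (the conjugate
cross term supplies the pairs `h < k`; the diagonal `h = k` carries `log 1 = 0`).
[cite: BalasubramanianConreyHeathBrown1985, Theorem 1] -/
theorem two_re_pairMain_eq (a : ℕ → ℂ) (N : ℕ) :
    2 * (∑ h ∈ Finset.Icc 1 N, ∑ k ∈ Finset.Icc 1 N,
        (if k ≤ h then a h * conj (a k) * ((Real.log ((h : ℝ) / k) / (Nat.lcm h k : ℝ) : ℝ) : ℂ) else 0)).re =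
      ∑ h ∈ Finset.Icc 1 N, ∑ k ∈ Finset.Icc 1 N,
        (a h * conj (a k)).re * (|Real.log ((h : ℝ) / k)| / (Nat.lcm h k : ℝ)) := by
  -- write `2·[k ≤ h] = [k ≤ h] + [k ≤ h]` and swap the indices in the second copy
  have hre : ∀ h k : ℕ, ((if k ≤ h then a h * conj (a k) *
      ((Real.log ((h : ℝ) / k) / (Nat.lcm h k : ℝ) : ℝ) : ℂ) else 0)).re =
      if k ≤ h then (a h * conj (a k)).re * (Real.log ((h : ℝ) / k) / (Nat.lcm h k : ℝ)) else 0 := by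
    intro h k
    split_ifs
    · rw [Complex.re_mul_ofReal]
    · simp
  rw [Complex.re_sum]
  simp_rw [Complex.re_sum, hre]
  rw [two_mul]
  conv_lhs => rw [show (∑ h ∈ Finset.Icc 1 N, ∑ k ∈ Finset.Icc 1 N,
      (if k ≤ h then (a h * conj (a k)).re * (Real.log ((h : ℝ) / k) / (Nat.lcm h k : ℝ)) else 0)) +
      (∑ h ∈ Finset.Icc 1 N, ∑ k ∈ Finset.Icc 1 N,
      (if k ≤ h then (a h * conj (a k)).re * (Real.log ((h : ℝ) / k) / (Nat.lcm h k : ℝ)) else 0)) =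
      (∑ h ∈ Finset.Icc 1 N, ∑ k ∈ Finset.Icc 1 N,
      (if k ≤ h then (a h * conj (a k)).re * (Real.log ((h : ℝ) / k) / (Nat.lcm h k : ℝ)) else 0)) +
      (∑ h ∈ Finset.Icc 1 N, ∑ k ∈ Finset.Icc 1 N,
      (if h ≤ k then (a k * conj (a h)).re * (Real.log ((k : ℝ) / h) / (Nat.lcm k h : ℝ)) else 0)) by
    congr 1; exact Finset.sum_comm]
  rw [← Finset.sum_add_distrib]
  refine Finset.sum_congr rfl fun h hh => ?_
  rw [← Finset.sum_add_distrib]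
  refine Finset.sum_congr rfl fun k hk => ?_
  have hh0 : (0 : ℝ) < h := by exact_mod_cast (Finset.mem_Icc.1 hh).1
  have hk0 : (0 : ℝ) < k := by exact_mod_cast (Finset.mem_Icc.1 hk).1
  have hsym : (a k * conj (a h)).re = (a h * conj (a k)).re := by
    rw [← Complex.conj_re (a h * conj (a k)), map_mul, Complex.conj_conj, mul_comm]
  have hlcm : (Nat.lcm k h : ℝ) = Nat.lcm h k := by rw [Nat.lcm_comm]
  have hlog : Real.log ((k : ℝ) / h) = -Real.log ((h : ℝ) / k) := by
    rw [← Real.log_inv, inv_div]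
  rcases lt_trichotomy k h with hlt | heq | hgt
  · -- `k < h`: only the first copy, `log(h/k) > 0`
    rw [if_pos hlt.le, if_neg (not_le.2 hlt), add_zero,
      abs_of_pos (Real.log_pos (by rw [lt_div_iff₀ hk0]; simpa using (show (k:ℝ) < h by exact_mod_cast hlt)))]
  · subst heq
    simp
  · -- `h < k`: only the second copy
    rw [if_neg (not_le.2 hgt), if_pos hgt.le, zero_add, hsym, hlcm, hlog,
      abs_of_neg (Real.log_neg (by positivity) (by rw [div_lt_one hk0]; exact_mod_cast hgt))]

end Literature.NumberTheory.LFunctions.BCH
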